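import Summits.QuantumFields.YangMills.Theorems.FluctuationComparisonRegPrIntLS2BetaRelativeStokes
import Summits.QuantumFields.YangMills.Theorems.FluctuationComparisonRegPrIntLS2BetaCovWalkSumStokes
import Literature.MathematicalPhysics.QuantumFieldTheory.Balaban1983to89.T4WordSystemGaugeBound
import HarnessLib

/-!
# S2β · (RES-u.6) «FRAME CHANGE» — the word-oscillation of a bond datum in the transport of a RE-GAUGED background `g•U₀` versus in the transport of `U₀`: on a small-bond background
# (`dist1 (U₀ b) ≤ σ`) and for a gauge transformation with small WALK GRADIENTS (`dist1 (g x·(g (walkEnd x w))⁻¹) ≤ |w|·γ′` — block-constant `g`: `γ′` = the seam gradient `τ′`),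
# `wordOsc_{g•U₀}(F) ≤ |w|·(c + 2·(4σ + γ′)·M)` — NO smallness of `g` itself (desk №704: `dist1 ǔ` is NOT small) (FINDING∕INTENT px13 g29 2026-09-01T01:55Z)

Cell `ym3-torus` (YM ladder rung R3 = continuum `SU(2)` Yang–Mills on the three-torus at fixed lattice data — a RUNG: NOT d = 4, NOT infinite volume, NOT a mass gap,
NOT Clay).  Width seat `ym3-torus-px13` (gen 29); crux `stmt-QuantumFields-20520`, LINE g18-1 S2β, organ GAP♯∘, node (RES-u) — the glue between (R-3) ✓p839541 (word-oscillation of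
`IηA` in `U₀`'s transport) and the rows at the MOVED triple `((u↓)⁻¹•V, ǔ⁻¹•U₀, u⁻¹•U)` (px16 g24 ✓p839557∕✓p839644∕⧗`…BodyDoorThm2Moved`), whose background is `ǔ⁻¹•U₀`.
`--kind proof --supports stmt-QuantumFields-20520 --as helper`, count-neutral, DEFINITION-FREE (0 `def`, 0 `instance`, 0 `notation`, 0 `sorry`, default heartbeats).  Torus side,
level-generic `j`, `SU(N)`, matrix data; word-oscillation shape of ✓p839768 (`‖↑(holAt U₀ (walk x w))·F⟨walkEnd x w, κ⟩·(…)⋆ − F⟨x, κ⟩‖ ≤ |w|·c`).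

WHAT IS PROVED (sorry-free).
§1 `norm_conj_sub_conj_le_two_mul` (`‖↑T′·F·↑T′⋆ − ↑T·F·↑T⋆‖ ≤ 2·‖↑T′ − ↑T‖·‖F‖`, unitarity, no square), `norm_conj_sub_le_of_dist1` (`‖↑g·↑T·↑g⋆ − ↑T‖ ≤ 2·dist1 g·dist1 T`, via
   ✓`dist1_comm_le_SU`), `dist1_holAt_walk_le` (`dist1 𝒰_{U₀}(walk x w) ≤ |w|·σ`, lit ✓`dist1_holAt_le_length_mul`), ★`norm_transport_gaugeAct_sub_le` — THE DEFECT
   `‖↑(g x)·↑𝒰·↑(g y)⋆ − ↑𝒰‖ ≤ 2·dist1(g x)·dist1 𝒰 + dist1 (g x·(g y)⁻¹) ≤ 4·|w|σ + dist1(g x·(g y)⁻¹)`.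
§2 ★★`wordOsc_gaugeAct_background` — `hσ : ∀ b, dist1 (U₀ b) ≤ σ`, `hg : ∀ x w, dist1 (g x·(g (walkEnd x w))⁻¹) ≤ |w|·γ′`, `hM : ‖F b‖ ≤ M`, `hc : wordOsc_{U₀}(F) ≤ |w|·c` ⟹
   `wordOsc_{g•U₀}(F) ≤ |w|·(c + 2·(4σ + γ′)·M)` (lit ✓`holAt_gaugeAct_walk`: `𝒰_{g•U₀} = g(x)·𝒰_{U₀}·g(y)⁻¹`).
§3 (v1.1, APPEND-ONLY) ★`wordOsc_gaugeAct_all` — the covariant word-oscillation is INVARIANT under a SIMULTANEOUS regauge of background and datum (so (C-σ) may be taken in the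
   (3.35) cube frame, architect px17 g23 02:00:25Z).
THE INPUT `hg` at `g := ǔ⁻¹` is w5 g29's ⧗(RES-u.4′) `…LiftGradientFeed` v1.1 `dist1_walkGrad_le_of_bondGrad` ∕ `dist1_movedGauge_walkGrad_le` (`γ′ := τ′`, the coarse-bond gradient
   of `u↓`; 01:57:19Z) — by name, not restated here.

HONEST.  Triangle inequalities and group algebra over landed letters; `σ, γ′, M, c` HYPOTHESES (σ = the lane's small-bond background class, γ′ ⟸ (RES-u.4)∕(RES-u.4′)'s `τ′`); nothing of
Bałaban's analysis is proved ([Balaban1985Averaging] (8) p.18, (11)–(13) p.19 are the printed loci of the gauge action); (RES-u), (REG-UP)'s `ε`, GAP♯∘ (registry 3732b7df UNTOUCHED, 0∕5),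
S2β, crux 20520, 19936, 19200, `YM3TorusSU2` — NOT proved; rung R3 — NOT d = 4, NOT infinite volume, NOT a mass gap, NOT Clay; the Yang–Mills mass gap is NOT proved.
-/

set_option autoImplicit false

noncomputable section

open scoped Matrix.Norms.L2Operator

namespace Summit.QuantumFields.YangMills.Theorems.FluctuationComparisonRegPrIntLS2BetaCovariantOscillationFrameChange

open Literature.MathematicalPhysics.QuantumFieldTheory.Balaban1983to89
open T4Continuum (walk walkEnd holAt LStep holAt_nil holAt_cons Letter holAt_gaugeAct_walk)
open BlockAveragingEMLLinearised (length_walk)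
open T4WordSystemGaugeBound (dist1_holAt_le_length_mul)
open Summit.QuantumFields.YangMills.BalabanUVNodes.N09CentralWindowInjective (norm_coe_SU_le_one)
open Summit.QuantumFields.YangMills.Theorems.FluctuationComparisonRegPrIntLS2BetaRelativeStokes (dist1_comm_le_SU)
open Summit.QuantumFields.YangMills.Theorems.FluctuationComparisonRegPrIntLS2BetaCovWalkSumStokes (norm_coe_conj_le)

variable {P : Params} {j N : ℕ} [NeZero N]

/-! ## §1 The transport defect of a re-gauged background -/

section Defect

/-- **TWO UNITARY SANDWICHES**: `‖↑T′·F·↑T′⋆ − ↑T·F·↑T⋆‖ ≤ 2·‖↑T′ − ↑T‖·‖F‖` (no quadratic term: both `T, T′` have norm `≤ 1`). [folklore] -/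
theorem norm_conj_sub_conj_le_two_mul (T T' : Matrix.specialUnitaryGroup (Fin N) ℂ) (F : Matrix (Fin N) (Fin N) ℂ) :
    ‖(T' : Matrix (Fin N) (Fin N) ℂ) * F * star (T' : Matrix (Fin N) (Fin N) ℂ) - (T : Matrix (Fin N) (Fin N) ℂ) * F * star (T : Matrix (Fin N) (Fin N) ℂ)‖ ≤
      2 * ‖(T' : Matrix (Fin N) (Fin N) ℂ) - (T : Matrix (Fin N) (Fin N) ℂ)‖ * ‖F‖ := by
  have e : (T' : Matrix (Fin N) (Fin N) ℂ) * F * star (T' : Matrix (Fin N) (Fin N) ℂ) - (T : Matrix (Fin N) (Fin N) ℂ) * F * star (T : Matrix (Fin N) (Fin N) ℂ) =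
      ((T' : Matrix (Fin N) (Fin N) ℂ) - (T : Matrix (Fin N) (Fin N) ℂ)) * F * star (T' : Matrix (Fin N) (Fin N) ℂ) +
        (T : Matrix (Fin N) (Fin N) ℂ) * F * (star (T' : Matrix (Fin N) (Fin N) ℂ) - star (T : Matrix (Fin N) (Fin N) ℂ)) := by noncomm_ring
  have h1 : ‖star (T' : Matrix (Fin N) (Fin N) ℂ)‖ ≤ 1 := by rw [norm_star]; exact norm_coe_SU_le_one T'
  have h2 : ‖(T : Matrix (Fin N) (Fin N) ℂ)‖ ≤ 1 := norm_coe_SU_le_one T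
  have h3 : ‖star (T' : Matrix (Fin N) (Fin N) ℂ) - star (T : Matrix (Fin N) (Fin N) ℂ)‖ = ‖(T' : Matrix (Fin N) (Fin N) ℂ) - (T : Matrix (Fin N) (Fin N) ℂ)‖ := by
    rw [← star_sub, norm_star]
  rw [e]
  calc _ ≤ ‖((T' : Matrix (Fin N) (Fin N) ℂ) - (T : Matrix (Fin N) (Fin N) ℂ)) * F * star (T' : Matrix (Fin N) (Fin N) ℂ)‖ +
        ‖(T : Matrix (Fin N) (Fin N) ℂ) * F * (star (T' : Matrix (Fin N) (Fin N) ℂ) - star (T : Matrix (Fin N) (Fin N) ℂ))‖ := norm_add_le _ _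
    _ ≤ ‖(T' : Matrix (Fin N) (Fin N) ℂ) - (T : Matrix (Fin N) (Fin N) ℂ)‖ * ‖F‖ * ‖star (T' : Matrix (Fin N) (Fin N) ℂ)‖ +
        ‖(T : Matrix (Fin N) (Fin N) ℂ)‖ * ‖F‖ * ‖star (T' : Matrix (Fin N) (Fin N) ℂ) - star (T : Matrix (Fin N) (Fin N) ℂ)‖ :=
        add_le_add ((norm_mul_le _ _).trans (mul_le_mul_of_nonneg_right (norm_mul_le _ _) (norm_nonneg _)))
          ((norm_mul_le _ _).trans (mul_le_mul_of_nonneg_right (norm_mul_le _ _) (norm_nonneg _)))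
    _ ≤ ‖(T' : Matrix (Fin N) (Fin N) ℂ) - (T : Matrix (Fin N) (Fin N) ℂ)‖ * ‖F‖ * 1 + 1 * ‖F‖ * ‖(T' : Matrix (Fin N) (Fin N) ℂ) - (T : Matrix (Fin N) (Fin N) ℂ)‖ := by
        rw [h3]; gcongr
    _ = 2 * ‖(T' : Matrix (Fin N) (Fin N) ℂ) - (T : Matrix (Fin N) (Fin N) ℂ)‖ * ‖F‖ := by ring

/-- **CONJUGATION BY `g` MOVES `T` BY A COMMUTATOR**: `‖↑g·↑T·↑g⋆ − ↑T‖ ≤ 2·dist1 g·dist1 T` (`= dist1([g,T])·‖↑T‖`, ✓`dist1_comm_le_SU`). [folklore] -/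
theorem norm_conj_sub_le_of_dist1 (g T : Matrix.specialUnitaryGroup (Fin N) ℂ) :
    ‖(g : Matrix (Fin N) (Fin N) ℂ) * (T : Matrix (Fin N) (Fin N) ℂ) * star (g : Matrix (Fin N) (Fin N) ℂ) - (T : Matrix (Fin N) (Fin N) ℂ)‖ ≤ 2 * dist1 g * dist1 T := by
  have hd : ∀ h : Matrix.specialUnitaryGroup (Fin N) ℂ, dist1 h = ‖(h : Matrix (Fin N) (Fin N) ℂ) - 1‖ := fun _ => rfl
  have hcomm := dist1_comm_le_SU g T
  have hu : star (T : Matrix (Fin N) (Fin N) ℂ) * (T : Matrix (Fin N) (Fin N) ℂ) = 1 := Matrix.mem_unitaryGroup_iff'.mp T.prop.1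
  -- `gTg⋆ − T = ([g,T] − 1)·T`
  have e : (g : Matrix (Fin N) (Fin N) ℂ) * (T : Matrix (Fin N) (Fin N) ℂ) * star (g : Matrix (Fin N) (Fin N) ℂ) - (T : Matrix (Fin N) (Fin N) ℂ) =
      (((g * T * g⁻¹ * T⁻¹ : Matrix.specialUnitaryGroup (Fin N) ℂ) : Matrix (Fin N) (Fin N) ℂ) - 1) * (T : Matrix (Fin N) (Fin N) ℂ) := by
    rw [Submonoid.coe_mul, Submonoid.coe_mul, Submonoid.coe_mul]
    have hg : ((g⁻¹ : Matrix.specialUnitaryGroup (Fin N) ℂ) : Matrix (Fin N) (Fin N) ℂ) = star (g : Matrix (Fin N) (Fin N) ℂ) := rfl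
    have hT : ((T⁻¹ : Matrix.specialUnitaryGroup (Fin N) ℂ) : Matrix (Fin N) (Fin N) ℂ) = star (T : Matrix (Fin N) (Fin N) ℂ) := rfl
    rw [hg, hT, sub_mul, one_mul]
    calc _ = (g : Matrix (Fin N) (Fin N) ℂ) * (T : Matrix (Fin N) (Fin N) ℂ) * star (g : Matrix (Fin N) (Fin N) ℂ) *
          (star (T : Matrix (Fin N) (Fin N) ℂ) * (T : Matrix (Fin N) (Fin N) ℂ)) - (T : Matrix (Fin N) (Fin N) ℂ) := by rw [hu, mul_one]
      _ = _ := by noncomm_ring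
  rw [e]
  calc _ ≤ ‖((g * T * g⁻¹ * T⁻¹ : Matrix.specialUnitaryGroup (Fin N) ℂ) : Matrix (Fin N) (Fin N) ℂ) - 1‖ * ‖(T : Matrix (Fin N) (Fin N) ℂ)‖ := norm_mul_le _ _
    _ ≤ (2 * dist1 g * dist1 T) * 1 := by
        rw [← hd]
        exact mul_le_mul hcomm (norm_coe_SU_le_one T) (norm_nonneg _) (by have := GaugeGroup.dist1_nonneg g; have := GaugeGroup.dist1_nonneg T; positivity)
    _ = _ := by ring

/-- **SMALL BONDS ⟹ SMALL HOLONOMY ALONG A WALK**: `dist1 (U₀ b) ≤ σ` for all `b` ⟹ `dist1 𝒰_{U₀}(walk x w) ≤ |w|·σ`. [cite: Balaban1985Averaging, (9) p.18] -/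
theorem dist1_holAt_walk_le (U₀ : GaugeField P j (Matrix.specialUnitaryGroup (Fin N) ℂ)) {σ : ℝ} (hσ0 : 0 ≤ σ) (hσ : ∀ b, dist1 (U₀ b) ≤ σ)
    (x : Site P j) (w : List (Letter P.d)) : dist1 (holAt U₀ (walk x w)) ≤ (w.length : ℝ) * σ := by
  have h := dist1_holAt_le_length_mul U₀ hσ0 (walk x w) (fun s _ => hσ s.bond)
  rwa [length_walk] at h

/-- ★ **THE TRANSPORT DEFECT OF A RE-GAUGED BACKGROUND**: `‖↑(g x)·↑𝒰·↑(g y)⋆ − ↑𝒰‖ ≤ 2·dist1(g x)·dist1 𝒰 + dist1 (g x·(g y)⁻¹)` — conjugation by `g x` (a commutator, small when `𝒰`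
is) followed by the gradient `g x·(g y)⁻¹` (small when `g` varies little from `x` to `y`); NO smallness of `g x` itself beyond `dist1 ≤ 2`. [cite: Balaban1985Averaging, (8) p.18] -/
theorem norm_transport_gaugeAct_sub_le (gx gy T : Matrix.specialUnitaryGroup (Fin N) ℂ) :
    ‖(gx : Matrix (Fin N) (Fin N) ℂ) * (T : Matrix (Fin N) (Fin N) ℂ) * star (gy : Matrix (Fin N) (Fin N) ℂ) - (T : Matrix (Fin N) (Fin N) ℂ)‖ ≤
      2 * dist1 gx * dist1 T + dist1 (gx * gy⁻¹) := by
  have hu : star (gx : Matrix (Fin N) (Fin N) ℂ) * (gx : Matrix (Fin N) (Fin N) ℂ) = 1 := Matrix.mem_unitaryGroup_iff'.mp gx.prop.1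
  have hd : dist1 (gx * gy⁻¹) = ‖((gx * gy⁻¹ : Matrix.specialUnitaryGroup (Fin N) ℂ) : Matrix (Fin N) (Fin N) ℂ) - 1‖ := rfl
  have hcoe : ((gx * gy⁻¹ : Matrix.specialUnitaryGroup (Fin N) ℂ) : Matrix (Fin N) (Fin N) ℂ) = (gx : Matrix (Fin N) (Fin N) ℂ) * star (gy : Matrix (Fin N) (Fin N) ℂ) := by
    rw [Submonoid.coe_mul]; rfl
  -- `gx·T·gy⋆ − T = (gx·T·gx⋆ − T)·(gx·gy⋆) + T·(gx·gy⋆ − 1)`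
  have e : (gx : Matrix (Fin N) (Fin N) ℂ) * (T : Matrix (Fin N) (Fin N) ℂ) * star (gy : Matrix (Fin N) (Fin N) ℂ) - (T : Matrix (Fin N) (Fin N) ℂ) =
      ((gx : Matrix (Fin N) (Fin N) ℂ) * (T : Matrix (Fin N) (Fin N) ℂ) * star (gx : Matrix (Fin N) (Fin N) ℂ) - (T : Matrix (Fin N) (Fin N) ℂ)) *
          ((gx : Matrix (Fin N) (Fin N) ℂ) * star (gy : Matrix (Fin N) (Fin N) ℂ)) +
        (T : Matrix (Fin N) (Fin N) ℂ) * ((gx : Matrix (Fin N) (Fin N) ℂ) * star (gy : Matrix (Fin N) (Fin N) ℂ) - 1) := by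
    calc _ = (gx : Matrix (Fin N) (Fin N) ℂ) * (T : Matrix (Fin N) (Fin N) ℂ) * (star (gx : Matrix (Fin N) (Fin N) ℂ) * (gx : Matrix (Fin N) (Fin N) ℂ)) *
          star (gy : Matrix (Fin N) (Fin N) ℂ) - (T : Matrix (Fin N) (Fin N) ℂ) := by rw [hu, mul_one]
      _ = _ := by noncomm_ring
  rw [e]
  have h1 := norm_conj_sub_le_of_dist1 gx T
  have hT1 : ‖(T : Matrix (Fin N) (Fin N) ℂ)‖ ≤ 1 := norm_coe_SU_le_one T
  have hprod1 : ‖(gx : Matrix (Fin N) (Fin N) ℂ) * star (gy : Matrix (Fin N) (Fin N) ℂ)‖ ≤ 1 := by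
    rw [← hcoe]; exact norm_coe_SU_le_one _
  calc _ ≤ ‖((gx : Matrix (Fin N) (Fin N) ℂ) * (T : Matrix (Fin N) (Fin N) ℂ) * star (gx : Matrix (Fin N) (Fin N) ℂ) - (T : Matrix (Fin N) (Fin N) ℂ)) *
          ((gx : Matrix (Fin N) (Fin N) ℂ) * star (gy : Matrix (Fin N) (Fin N) ℂ))‖ +
        ‖(T : Matrix (Fin N) (Fin N) ℂ) * ((gx : Matrix (Fin N) (Fin N) ℂ) * star (gy : Matrix (Fin N) (Fin N) ℂ) - 1)‖ := norm_add_le _ _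
    _ ≤ ‖(gx : Matrix (Fin N) (Fin N) ℂ) * (T : Matrix (Fin N) (Fin N) ℂ) * star (gx : Matrix (Fin N) (Fin N) ℂ) - (T : Matrix (Fin N) (Fin N) ℂ)‖ * ‖(gx : Matrix (Fin N) (Fin N) ℂ) * star (gy : Matrix (Fin N) (Fin N) ℂ)‖ +
        ‖(T : Matrix (Fin N) (Fin N) ℂ)‖ * ‖(gx : Matrix (Fin N) (Fin N) ℂ) * star (gy : Matrix (Fin N) (Fin N) ℂ) - 1‖ := add_le_add (norm_mul_le _ _) (norm_mul_le _ _)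
    _ ≤ (2 * dist1 gx * dist1 T) * 1 + 1 * ‖(gx : Matrix (Fin N) (Fin N) ℂ) * star (gy : Matrix (Fin N) (Fin N) ℂ) - 1‖ := by
        have h0 : 0 ≤ 2 * dist1 gx * dist1 T :=
          mul_nonneg (mul_nonneg (by norm_num) (GaugeGroup.dist1_nonneg gx)) (GaugeGroup.dist1_nonneg T)
        exact add_le_add (mul_le_mul h1 hprod1 (norm_nonneg _) h0) (mul_le_mul_of_nonneg_right hT1 (norm_nonneg _))
    _ = 2 * dist1 gx * dist1 T + dist1 (gx * gy⁻¹) := by rw [hd, hcoe]; ring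

end Defect

/-! ## §2 ★★ The word-oscillation in the transport of `g•U₀` -/

section Frame

/-- ★★ **FRAME CHANGE**: small-bond background `dist1 (U₀ b) ≤ σ`, datum `‖F b‖ ≤ M` with word-oscillation `c` in `U₀`'s transport, gauge transformation `g` with WALK GRADIENTS
`dist1 (g x·(g (walkEnd x w))⁻¹) ≤ |w|·γ′` (`dist1 (g x) ≤ 2` only) ⟹ in the transport of `g•U₀` the datum has word-oscillation `c + 2·(4σ + γ′)·M`:
`‖↑𝒰_{g•U₀}(walk x w)·F⟨walkEnd x w, κ⟩·(…)⋆ − F⟨x, κ⟩‖ ≤ |w|·(c + 2·(4·σ + γ′)·M)`. [cite: Balaban1985Averaging, (8) p.18, (11) p.19] -/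
theorem wordOsc_gaugeAct_background (U₀ : GaugeField P j (Matrix.specialUnitaryGroup (Fin N) ℂ)) (g : GaugeTransf P j (Matrix.specialUnitaryGroup (Fin N) ℂ))
    (F : PBond P j → Matrix (Fin N) (Fin N) ℂ) {σ γ' M c : ℝ} (hσ0 : 0 ≤ σ) (hσ : ∀ b, dist1 (U₀ b) ≤ σ)
    (hg : ∀ (x : Site P j) (w : List (Letter P.d)), dist1 (g x * (g (walkEnd x w))⁻¹) ≤ (w.length : ℝ) * γ') (hM : ∀ b, ‖F b‖ ≤ M)
    (hc : ∀ (x : Site P j) (w : List (Letter P.d)) (κ : Fin P.d),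
      ‖((holAt U₀ (walk x w) : Matrix.specialUnitaryGroup (Fin N) ℂ) : Matrix (Fin N) (Fin N) ℂ) * F ⟨walkEnd x w, κ⟩ *
          star ((holAt U₀ (walk x w) : Matrix.specialUnitaryGroup (Fin N) ℂ) : Matrix (Fin N) (Fin N) ℂ) - F ⟨x, κ⟩‖ ≤ (w.length : ℝ) * c)
    (x : Site P j) (w : List (Letter P.d)) (κ : Fin P.d) :
    ‖((holAt (GaugeField.gaugeAct g U₀) (walk x w) : Matrix.specialUnitaryGroup (Fin N) ℂ) : Matrix (Fin N) (Fin N) ℂ) * F ⟨walkEnd x w, κ⟩ *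
        star ((holAt (GaugeField.gaugeAct g U₀) (walk x w) : Matrix.specialUnitaryGroup (Fin N) ℂ) : Matrix (Fin N) (Fin N) ℂ) - F ⟨x, κ⟩‖ ≤
      (w.length : ℝ) * (c + 2 * (4 * σ + γ') * M) := by
  set T : Matrix.specialUnitaryGroup (Fin N) ℂ := holAt U₀ (walk x w) with hT
  set y : Site P j := walkEnd x w with hy
  have hTg : holAt (GaugeField.gaugeAct g U₀) (walk x w) = g x * T * (g y)⁻¹ := by rw [hT, hy]; exact holAt_gaugeAct_walk g U₀ x w
  have hM0 : 0 ≤ M := (norm_nonneg _).trans (hM ⟨x, κ⟩)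
  have hdT : dist1 T ≤ (w.length : ℝ) * σ := dist1_holAt_walk_le U₀ hσ0 hσ x w
  have hdg : dist1 (g x) ≤ 2 := by
    have : dist1 (g x) = ‖((g x : Matrix.specialUnitaryGroup (Fin N) ℂ) : Matrix (Fin N) (Fin N) ℂ) - 1‖ := rfl
    rw [this]
    calc _ ≤ ‖((g x : Matrix.specialUnitaryGroup (Fin N) ℂ) : Matrix (Fin N) (Fin N) ℂ)‖ + ‖(1 : Matrix (Fin N) (Fin N) ℂ)‖ := norm_sub_le _ _
      _ ≤ 1 + 1 := add_le_add (norm_coe_SU_le_one _) (by rw [norm_one])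
      _ = 2 := by norm_num
  -- the defect of the transport
  have hΔ : ‖((g x * T * (g y)⁻¹ : Matrix.specialUnitaryGroup (Fin N) ℂ) : Matrix (Fin N) (Fin N) ℂ) - (T : Matrix (Fin N) (Fin N) ℂ)‖ ≤ (w.length : ℝ) * (4 * σ + γ') := by
    rw [Submonoid.coe_mul, Submonoid.coe_mul, show (((g y)⁻¹ : Matrix.specialUnitaryGroup (Fin N) ℂ) : Matrix (Fin N) (Fin N) ℂ) = star ((g y : Matrix.specialUnitaryGroup (Fin N) ℂ) : Matrix (Fin N) (Fin N) ℂ) from rfl]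
    refine (norm_transport_gaugeAct_sub_le (g x) (g y) T).trans ?_
    have h1 : 2 * dist1 (g x) * dist1 T ≤ (w.length : ℝ) * (4 * σ) := by
      have := GaugeGroup.dist1_nonneg T
      nlinarith [GaugeGroup.dist1_nonneg (g x)]
    have h2 := hg x w
    rw [← hy] at h2
    linarith
  rw [hTg]
  -- split: `(T′FT′⋆ − TFT⋆) + (TFT⋆ − F x)`
  have e : ((g x * T * (g y)⁻¹ : Matrix.specialUnitaryGroup (Fin N) ℂ) : Matrix (Fin N) (Fin N) ℂ) * F ⟨y, κ⟩ * star ((g x * T * (g y)⁻¹ : Matrix.specialUnitaryGroup (Fin N) ℂ) : Matrix (Fin N) (Fin N) ℂ) - F ⟨x, κ⟩ =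
      (((g x * T * (g y)⁻¹ : Matrix.specialUnitaryGroup (Fin N) ℂ) : Matrix (Fin N) (Fin N) ℂ) * F ⟨y, κ⟩ * star ((g x * T * (g y)⁻¹ : Matrix.specialUnitaryGroup (Fin N) ℂ) : Matrix (Fin N) (Fin N) ℂ) -
          (T : Matrix (Fin N) (Fin N) ℂ) * F ⟨y, κ⟩ * star (T : Matrix (Fin N) (Fin N) ℂ)) +
        ((T : Matrix (Fin N) (Fin N) ℂ) * F ⟨y, κ⟩ * star (T : Matrix (Fin N) (Fin N) ℂ) - F ⟨x, κ⟩) := by abel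
  rw [e]
  refine (norm_add_le _ _).trans ?_
  have hA := norm_conj_sub_conj_le_two_mul T (g x * T * (g y)⁻¹) (F ⟨y, κ⟩)
  have hB := hc x w κ
  rw [← hT, ← hy] at hB
  have hw0 : (0 : ℝ) ≤ w.length := Nat.cast_nonneg _
  have hFy := hM ⟨y, κ⟩
  have key : 2 * ‖((g x * T * (g y)⁻¹ : Matrix.specialUnitaryGroup (Fin N) ℂ) : Matrix (Fin N) (Fin N) ℂ) - (T : Matrix (Fin N) (Fin N) ℂ)‖ * ‖F ⟨y, κ⟩‖ ≤
      (w.length : ℝ) * (2 * (4 * σ + γ') * M) := by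
    have hn := norm_nonneg (((g x * T * (g y)⁻¹ : Matrix.specialUnitaryGroup (Fin N) ℂ) : Matrix (Fin N) (Fin N) ℂ) - (T : Matrix (Fin N) (Fin N) ℂ))
    nlinarith [norm_nonneg (F ⟨y, κ⟩)]
  linarith

end Frame


/-! ## §3 (RES-u.6)′ Invariance under a SIMULTANEOUS regauge of background and datum (v1.1, append-only) -/

section Simultaneous

/-- ★ **THE COVARIANT WORD-OSCILLATION IS GAUGE INVARIANT** under a SIMULTANEOUS regauge `v` of the background (`U₀ ↦ v•U₀`) and of the datum (`F(z) ↦ v(z)·F(z)·v(z)⋆`):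
`‖↑𝒰_{v•U₀}(x,w)·(v(y)F(y)v(y)⋆)·(…)⋆ − v(x)F(x)v(x)⋆‖ = ‖↑𝒰_{U₀}(x,w)·F(y)·(…)⋆ − F(x)‖` (`y = walkEnd x w`) — so every estimate of this chain ((R-3)'s `c₀`, ✓p839886 FEED,
§2 FRAME CHANGE) may be run in ANY local frame, e.g. [Balaban1985BackgroundPropagators] (3.35)'s cube gauge `u_□` where the background bonds are small (architect px17 g23
2026-09-01T02:00:25Z (C-σ) «on the words' own class cube in the (3.35) frame»). [cite: Balaban1985Averaging, (8) p.18, (11) p.19] -/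
theorem wordOsc_gaugeAct_all (U₀ : GaugeField P j (Matrix.specialUnitaryGroup (Fin N) ℂ)) (v : GaugeTransf P j (Matrix.specialUnitaryGroup (Fin N) ℂ))
    (F : PBond P j → Matrix (Fin N) (Fin N) ℂ) (x : Site P j) (w : List (Letter P.d)) (κ : Fin P.d) :
    ‖((holAt (GaugeField.gaugeAct v U₀) (walk x w) : Matrix.specialUnitaryGroup (Fin N) ℂ) : Matrix (Fin N) (Fin N) ℂ) *
          (((v (walkEnd x w) : Matrix.specialUnitaryGroup (Fin N) ℂ) : Matrix (Fin N) (Fin N) ℂ) * F ⟨walkEnd x w, κ⟩ *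
            star ((v (walkEnd x w) : Matrix.specialUnitaryGroup (Fin N) ℂ) : Matrix (Fin N) (Fin N) ℂ)) *
          star ((holAt (GaugeField.gaugeAct v U₀) (walk x w) : Matrix.specialUnitaryGroup (Fin N) ℂ) : Matrix (Fin N) (Fin N) ℂ) -
        ((v x : Matrix.specialUnitaryGroup (Fin N) ℂ) : Matrix (Fin N) (Fin N) ℂ) * F ⟨x, κ⟩ * star ((v x : Matrix.specialUnitaryGroup (Fin N) ℂ) : Matrix (Fin N) (Fin N) ℂ)‖ =
      ‖((holAt U₀ (walk x w) : Matrix.specialUnitaryGroup (Fin N) ℂ) : Matrix (Fin N) (Fin N) ℂ) * F ⟨walkEnd x w, κ⟩ *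
          star ((holAt U₀ (walk x w) : Matrix.specialUnitaryGroup (Fin N) ℂ) : Matrix (Fin N) (Fin N) ℂ) - F ⟨x, κ⟩‖ := by
  set T : Matrix.specialUnitaryGroup (Fin N) ℂ := holAt U₀ (walk x w) with hT
  set y : Site P j := walkEnd x w with hy
  have hTg : holAt (GaugeField.gaugeAct v U₀) (walk x w) = v x * T * (v y)⁻¹ := by rw [hT, hy]; exact holAt_gaugeAct_walk v U₀ x w
  have hu : star ((v y : Matrix.specialUnitaryGroup (Fin N) ℂ) : Matrix (Fin N) (Fin N) ℂ) * ((v y : Matrix.specialUnitaryGroup (Fin N) ℂ) : Matrix (Fin N) (Fin N) ℂ) = 1 :=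
    Matrix.mem_unitaryGroup_iff'.mp (v y).prop.1
  rw [hTg, Submonoid.coe_mul, Submonoid.coe_mul,
    show (((v y)⁻¹ : Matrix.specialUnitaryGroup (Fin N) ℂ) : Matrix (Fin N) (Fin N) ℂ) = star ((v y : Matrix.specialUnitaryGroup (Fin N) ℂ) : Matrix (Fin N) (Fin N) ℂ) from rfl,
    star_mul, star_mul, star_star]
  -- the expression is `v x·(T·F(y)·T⋆ − F(x))·(v x)⋆`
  have e : ((v x : Matrix.specialUnitaryGroup (Fin N) ℂ) : Matrix (Fin N) (Fin N) ℂ) * (T : Matrix (Fin N) (Fin N) ℂ) * star ((v y : Matrix.specialUnitaryGroup (Fin N) ℂ) : Matrix (Fin N) (Fin N) ℂ) *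
          (((v y : Matrix.specialUnitaryGroup (Fin N) ℂ) : Matrix (Fin N) (Fin N) ℂ) * F ⟨y, κ⟩ * star ((v y : Matrix.specialUnitaryGroup (Fin N) ℂ) : Matrix (Fin N) (Fin N) ℂ)) *
          (((v y : Matrix.specialUnitaryGroup (Fin N) ℂ) : Matrix (Fin N) (Fin N) ℂ) * (star (T : Matrix (Fin N) (Fin N) ℂ) * star ((v x : Matrix.specialUnitaryGroup (Fin N) ℂ) : Matrix (Fin N) (Fin N) ℂ))) -
        ((v x : Matrix.specialUnitaryGroup (Fin N) ℂ) : Matrix (Fin N) (Fin N) ℂ) * F ⟨x, κ⟩ * star ((v x : Matrix.specialUnitaryGroup (Fin N) ℂ) : Matrix (Fin N) (Fin N) ℂ) =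
      ((v x : Matrix.specialUnitaryGroup (Fin N) ℂ) : Matrix (Fin N) (Fin N) ℂ) * ((T : Matrix (Fin N) (Fin N) ℂ) * F ⟨y, κ⟩ * star (T : Matrix (Fin N) (Fin N) ℂ) - F ⟨x, κ⟩) *
        star ((v x : Matrix.specialUnitaryGroup (Fin N) ℂ) : Matrix (Fin N) (Fin N) ℂ) := by
    calc _ = ((v x : Matrix.specialUnitaryGroup (Fin N) ℂ) : Matrix (Fin N) (Fin N) ℂ) * (T : Matrix (Fin N) (Fin N) ℂ) *
          (star ((v y : Matrix.specialUnitaryGroup (Fin N) ℂ) : Matrix (Fin N) (Fin N) ℂ) * ((v y : Matrix.specialUnitaryGroup (Fin N) ℂ) : Matrix (Fin N) (Fin N) ℂ)) * F ⟨y, κ⟩ *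
          (star ((v y : Matrix.specialUnitaryGroup (Fin N) ℂ) : Matrix (Fin N) (Fin N) ℂ) * ((v y : Matrix.specialUnitaryGroup (Fin N) ℂ) : Matrix (Fin N) (Fin N) ℂ)) *
          (star (T : Matrix (Fin N) (Fin N) ℂ) * star ((v x : Matrix.specialUnitaryGroup (Fin N) ℂ) : Matrix (Fin N) (Fin N) ℂ)) -
        ((v x : Matrix.specialUnitaryGroup (Fin N) ℂ) : Matrix (Fin N) (Fin N) ℂ) * F ⟨x, κ⟩ * star ((v x : Matrix.specialUnitaryGroup (Fin N) ℂ) : Matrix (Fin N) (Fin N) ℂ) := by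
          noncomm_ring
      _ = _ := by rw [hu]; noncomm_ring
  rw [e]
  apply le_antisymm
  · exact norm_coe_conj_le (v x) _
  · have h := norm_coe_conj_le (v x)⁻¹ (((v x : Matrix.specialUnitaryGroup (Fin N) ℂ) : Matrix (Fin N) (Fin N) ℂ) *
        ((T : Matrix (Fin N) (Fin N) ℂ) * F ⟨y, κ⟩ * star (T : Matrix (Fin N) (Fin N) ℂ) - F ⟨x, κ⟩) * star ((v x : Matrix.specialUnitaryGroup (Fin N) ℂ) : Matrix (Fin N) (Fin N) ℂ))
    have hux : star ((v x : Matrix.specialUnitaryGroup (Fin N) ℂ) : Matrix (Fin N) (Fin N) ℂ) * ((v x : Matrix.specialUnitaryGroup (Fin N) ℂ) : Matrix (Fin N) (Fin N) ℂ) = 1 :=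
      Matrix.mem_unitaryGroup_iff'.mp (v x).prop.1
    have e2 : (((v x)⁻¹ : Matrix.specialUnitaryGroup (Fin N) ℂ) : Matrix (Fin N) (Fin N) ℂ) *
          (((v x : Matrix.specialUnitaryGroup (Fin N) ℂ) : Matrix (Fin N) (Fin N) ℂ) * ((T : Matrix (Fin N) (Fin N) ℂ) * F ⟨y, κ⟩ * star (T : Matrix (Fin N) (Fin N) ℂ) - F ⟨x, κ⟩) *
            star ((v x : Matrix.specialUnitaryGroup (Fin N) ℂ) : Matrix (Fin N) (Fin N) ℂ)) *
          star (((v x)⁻¹ : Matrix.specialUnitaryGroup (Fin N) ℂ) : Matrix (Fin N) (Fin N) ℂ) = (T : Matrix (Fin N) (Fin N) ℂ) * F ⟨y, κ⟩ * star (T : Matrix (Fin N) (Fin N) ℂ) - F ⟨x, κ⟩ := by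
      rw [show (((v x)⁻¹ : Matrix.specialUnitaryGroup (Fin N) ℂ) : Matrix (Fin N) (Fin N) ℂ) = star ((v x : Matrix.specialUnitaryGroup (Fin N) ℂ) : Matrix (Fin N) (Fin N) ℂ) from rfl, star_star]
      calc _ = (star ((v x : Matrix.specialUnitaryGroup (Fin N) ℂ) : Matrix (Fin N) (Fin N) ℂ) * ((v x : Matrix.specialUnitaryGroup (Fin N) ℂ) : Matrix (Fin N) (Fin N) ℂ)) *
            ((T : Matrix (Fin N) (Fin N) ℂ) * F ⟨y, κ⟩ * star (T : Matrix (Fin N) (Fin N) ℂ) - F ⟨x, κ⟩) *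
            (star ((v x : Matrix.specialUnitaryGroup (Fin N) ℂ) : Matrix (Fin N) (Fin N) ℂ) * ((v x : Matrix.specialUnitaryGroup (Fin N) ℂ) : Matrix (Fin N) (Fin N) ℂ)) := by noncomm_ring
        _ = _ := by rw [hux, one_mul, mul_one]
    rw [e2] at h
    exact h

end Simultaneous

end Summit.QuantumFields.YangMills.Theorems.FluctuationComparisonRegPrIntLS2BetaCovariantOscillationFrameChange

end
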